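import Summits.Ventures.CertifiedManyBodySolver.Downfold.EmeryFermiSurfaceShape
import Summits.Ventures.CertifiedManyBodySolver.Downfold.EmeryFermiOneBandRange
import HarnessLib

/-!
# THE HARMONIC CONTENT OF THE EXACT FERMI SURFACE: which one-body extension of the σ quartet generates
# which one-band hopping AT the Fermi surface — the same-sublattice oxygen hopping `t_pp″` gives an exact
# `t″`, the direct Cu–Cu hopping `t_dd` gives exact `t″` and `t‴` (range `(2,1)`, no `(2,2)`), both a range-3 term

Venture CertifiedManyBodySolver, cell `pub/hubbard-downfold` (stage S1; D-0096/D-0098), seat hubbard-downfold-mod-4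
(technique B, g44; INFL-3to1-B §B.99); namespace `Summit.Ventures.CertifiedManyBodySolver.Downfold.Emery`. All PROVED.
SETTING. `EmeryFermiSurfaceShape` (§B.13): for the σ quartet `(Δ, t_pd, t_pp, t_pp′)` minus the secular
determinant is BILINEAR in `x = sin²(kx/2)`, `y = sin²(ky/2)` at fixed energy ⇒ every constant-energy contour is
exactly a `t–t′` contour. Two printed one-body terms the quartet cannot represent (box #18 La₂CuO₄ §DFT-3b «t_pp″
NOT representable ⇒ MODEL-FORM flag»; box #19 @10 GPa pair rows with `t_dd`, §B.13 (4) «numerics only») are added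
and read EXACTLY: `t_pp″ = c₂` = hopping between like oxygen orbitals of the SAME sublattice one lattice vector
apart, perpendicular to the orbital axis (`p_x(r) ↔ p_x(r ± aŷ)`; diagonal `−4c₂sin²(ky/2)` on `p_x`,
`−4c₂sin²(kx/2)` on `p_y` — the convention of `bloch4`'s through-Cu `t_pp′ = c`, level at Γ unchanged);
`t_dd = d` = direct d–d hopping (`2d(cos kx + cos ky)` on `d`).

RESULTS (`bloch6`, `charPoly6 = −det(bloch6 − ε)`, `det_bloch6_sub_eq_neg_charPoly6`).
* §2 `charPoly6_poly`: minus the secular determinant is `a₀ + a₁(x + y) + a₂·xy + a₃(x² + y²) + a₅(x²y + xy²)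
  + 64dcc₂(x³ + y³)` — POLYNOMIAL DEGREE = HOPPING RANGE of the exact one-band contour: quartet bilinear
  (`t, t′`); `t_pp″` adds `x² + y²` (↔ `t″`) only; `t_dd` adds `(x + y)²` and `x²y + xy²` (↔ `t″`, `t‴`; never
  `x²y²`, no `t⁗`); both together `x³ + y³` (range 3).
* §3 THE `t_pp″` LAW (`d = 0`): `charPoly6 = cA − 4fsD5(x + y) − 16fsN5·xy − 16fsM5(x² + y²)`,
  `fsD5 = (Δ + ε)(t_pd² − (c + c₂)ε)`, `fsN5 = 2t_pd²(t_pp + c) + ε(t_pp² − c² − c₂²)`, **`fsM5 = c₂(t_pd² − cε)`**: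
  EVERY constant-energy contour of the σ + `t_pp″` model is EXACTLY a `t–t′–t″` contour,
  `(t, t′, t″) ∝ (fsT5, −fsN5, −fsM5)` (`charPoly6_tdd_zero_eq_zero_iff_oneBandXY`, k-space
  `det_bloch6_tdd_zero_eq_zero_iff_oneBand`), **`t″/t′ = fsM5/fsN5`** (`fsTpp5_div_fsTp5`); SIGN = that of `−c₂`
  in the cuprate regime (`fsTpp5_pos_iff`: negative `t_pp″` — direct `ppπ` overlap — is cuprate-like, `t″ > 0`);
  ENERGY-FREE SIZE BOUND **`|t″/t′| ≤ |c₂|/(2(t_pp + c))`** for `0 ≤ c`, `0 ≤ ε`, `cε ≤ t_pd²`, `c² + c₂² ≤ t_pp²`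
  (`abs_fsM5_div_fsN5_le`); `c₂ = 0` recovers §B.13 (`fsD5_zero`, `fsN5_zero`, `fsM5_zero`, `charPoly6_zero_zero`).
* §4 THE `t_dd` LAW (`c₂ = 0`): `charPoly6 = ddK − oneBand5 ddT ddT1 ddT2 ddT3 0` in cosines
  (`charPoly6_c2_zero_cos`), **`t‴ = ddT3 = d(t_pp² − c²)`**, `t″ = ddT2 = d((Δ + ε)c − 2(t_pp² − c²))`,
  `t′ = ddT1 = −fsN + 2ddT2`, `t = ddT`: every contour of the σ + `t_dd` model is EXACTLY a `t–t′–t″–t‴` contour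
  with no `(2,2)` star (`det_bloch6_c2_zero_eq_zero_iff_oneBand5`); `t_dd` reaches the `(2,1)` star only THROUGH
  the oxygen hoppings (`ddT3_eq_zero_iff`) and `t‴/t″` does not depend on `t_dd` (`ddT3_div_ddT2`).
* §5 scale covariance (`charPoly6_smul`, `fsM5_div_fsN5_smul`). WHAT THIS IS NOT: statements about materials
(readings of typed rows: INFLATION-RULES-3to1-B §B.99); the SCALE of `(fsT5, −fsN5, −fsM5)` / `(ddT, …)` is
conventional — only ratios and contours are physical; not the Fermi ENERGY of the extended models (statements hold
at every energy); `U = 0` kinematics. Sources: [HybertsenSchluterChristensen1989, Eq. (1)]; [AndersenEtAl1995, §6].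
-/

noncomputable section

namespace Summit.Ventures.CertifiedManyBodySolver.Downfold.Emery

open Real

/-! ## §1 The σ Bloch matrix extended by `t_pp″ = c₂` and `t_dd = d` -/

/-- The σ three-band Bloch matrix (`bloch4`: electron picture, real gauge, `ε_d = 0`, `ε_p = −Δ`,
`sx = sin(kx/2)`, `sy = sin(ky/2)`) extended by the same-sublattice oxygen hopping `t_pp″ = c₂`
(`−4c₂sy²` on `p_x`, `−4c₂sx²` on `p_y`) and the direct Cu–Cu hopping `t_dd = d` (`4d(1 − sx² − sy²) =
2d(cos kx + cos ky)` on `d`). [cite: HybertsenSchluterChristensen1989, Eq. (1) (three-band d–p model)] -/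
def bloch6 (Δ tpd tpp c c₂ d sx sy : ℝ) : Matrix (Fin 3) (Fin 3) ℝ :=
  !![4 * d * (1 - sx ^ 2 - sy ^ 2), 2 * tpd * sx, -2 * tpd * sy;
     2 * tpd * sx, -Δ - 4 * c * sx ^ 2 - 4 * c₂ * sy ^ 2, -4 * tpp * sx * sy;
     -2 * tpd * sy, -4 * tpp * sx * sy, -Δ - 4 * c * sy ^ 2 - 4 * c₂ * sx ^ 2]

/-- With `c₂ = d = 0` the matrix is the quartet's `bloch4`. [folklore] -/
theorem bloch6_zero_zero (Δ tpd tpp c sx sy : ℝ) :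
    bloch6 Δ tpd tpp c 0 0 sx sy = bloch4 Δ tpd tpp c sx sy := by
  ext i j
  fin_cases i <;> fin_cases j <;> simp [bloch6, bloch4]

/-- Minus the characteristic determinant of `bloch6` as a function of `x = sx²`, `y = sy²` and the energy
`ε` (a monic cubic in `ε`):
`(ε − 4d(1 − x − y))·[(Δ + 4cx + 4c₂y + ε)(Δ + 4cy + 4c₂x + ε) − 16t_pp²xy] − 4t_pd²x(Δ + 4cy + 4c₂x + ε)
 − 4t_pd²y(Δ + 4cx + 4c₂y + ε) − 32t_pd²t_pp·xy`. [folklore] -/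
def charPoly6 (Δ tpd tpp c c₂ d x y ε : ℝ) : ℝ :=
  (ε - 4 * d * (1 - x - y)) *
      ((Δ + 4 * c * x + 4 * c₂ * y + ε) * (Δ + 4 * c * y + 4 * c₂ * x + ε) - 16 * tpp ^ 2 * x * y)
    - 4 * tpd ^ 2 * x * (Δ + 4 * c * y + 4 * c₂ * x + ε)
    - 4 * tpd ^ 2 * y * (Δ + 4 * c * x + 4 * c₂ * y + ε) - 32 * tpd ^ 2 * tpp * x * y

/-- Characteristic determinant of `bloch6` as an explicit cubic (all k). [folklore] -/
theorem det_bloch6_sub (Δ tpd tpp c c₂ d sx sy ε : ℝ) :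
    (bloch6 Δ tpd tpp c c₂ d sx sy - ε • (1 : Matrix (Fin 3) (Fin 3) ℝ)).det =
      (4 * d * (1 - sx ^ 2 - sy ^ 2) - ε)
          * ((-Δ - 4 * c * sx ^ 2 - 4 * c₂ * sy ^ 2 - ε) * (-Δ - 4 * c * sy ^ 2 - 4 * c₂ * sx ^ 2 - ε)
              - (4 * tpp * sx * sy) ^ 2)
        + (2 * tpd * sx) ^ 2 * (-Δ - 4 * c * sy ^ 2 - 4 * c₂ * sx ^ 2 - ε) * (-1)
        + (2 * tpd * sy) ^ 2 * (-Δ - 4 * c * sx ^ 2 - 4 * c₂ * sy ^ 2 - ε) * (-1)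
        + 2 * (2 * tpd * sx) * (-2 * tpd * sy) * (-4 * tpp * sx * sy) := by
  simp [bloch6, Matrix.det_fin_three, Matrix.sub_apply, Matrix.smul_apply]
  ring

/-- `det(bloch6 − ε·1) = −charPoly6(sx², sy², ε)`: the secular equation depends on k only through
`x = sx²`, `y = sy²`. [folklore] -/
theorem det_bloch6_sub_eq_neg_charPoly6 (Δ tpd tpp c c₂ d sx sy ε : ℝ) :
    (bloch6 Δ tpd tpp c c₂ d sx sy - ε • (1 : Matrix (Fin 3) (Fin 3) ℝ)).det =
      -charPoly6 Δ tpd tpp c c₂ d (sx ^ 2) (sy ^ 2) ε := by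
  rw [det_bloch6_sub]
  unfold charPoly6
  ring

/-- With `c₂ = d = 0`, `charPoly6` is the quartet's `charCubic` (§B.13). [folklore] -/
theorem charPoly6_zero_zero (Δ tpd tpp c x y ε : ℝ) :
    charPoly6 Δ tpd tpp c 0 0 x y ε = charCubic Δ tpd tpp c x y ε := by
  unfold charPoly6 charCubic
  ring

/-! ## §2 Polynomial degree = hopping range: the symmetric expansion of `charPoly6` -/

/-- The nearest-neighbour weight with `t_pp″`: `fsD5 = (Δ + ε)(t_pd² − (c + c₂)ε)`. [folklore] -/
def fsD5 (Δ tpd c c₂ ε : ℝ) : ℝ := (Δ + ε) * (tpd ^ 2 - (c + c₂) * ε)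

/-- The diagonal (`t′`-type, `xy`) weight with `t_pp″`: `fsN5 = 2t_pd²(c + t_pp) + ε(t_pp² − c² − c₂²)`.
[folklore] -/
def fsN5 (tpd tpp c c₂ ε : ℝ) : ℝ := 2 * tpd ^ 2 * (c + tpp) + ε * (tpp ^ 2 - c ^ 2 - c₂ ^ 2)

/-- The `x² + y²` (`t″`-type) weight generated by `t_pp″`: `fsM5 = c₂(t_pd² − cε)`. [folklore] -/
def fsM5 (tpd c c₂ ε : ℝ) : ℝ := c₂ * (tpd ^ 2 - c * ε)

/-- POLYNOMIAL DEGREE = HOPPING RANGE: at fixed energy `charPoly6` is the symmetric polynomial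
`(cA − 4d(Δ+ε)²) + a₁(x + y) + a₂·xy + a₃(x² + y²) + a₅(x²y + xy²) + 64dcc₂·(x³ + y³)` with
`a₁ = −4fsD5 − 16d(Δ+ε)(c + c₂) + 4d(Δ+ε)²`, `a₂ = −16fsN5 − 64d(c² + c₂² − t_pp²) + 32d(Δ+ε)(c + c₂)`,
`a₃ = −16fsM5 − 64dcc₂ + 16d(Δ+ε)(c + c₂)`, `a₅ = 64d(c² + c₂² − t_pp² + cc₂)`: the quartet is bilinear, `t_pp″`
adds `x² + y²` only, `t_dd` adds `(x + y)²` and `x²y + xy²`, both together `x³ + y³`; never `x²y²`.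
[cite: AndersenEtAl1995, §6 (contour = polynomial in `x`, `y`)] -/
theorem charPoly6_poly (Δ tpd tpp c c₂ d x y ε : ℝ) :
    charPoly6 Δ tpd tpp c c₂ d x y ε =
      (cA Δ ε - 4 * d * (Δ + ε) ^ 2)
      + (-4 * fsD5 Δ tpd c c₂ ε - 16 * d * (Δ + ε) * (c + c₂) + 4 * d * (Δ + ε) ^ 2) * (x + y)
      + (-16 * fsN5 tpd tpp c c₂ ε - 64 * d * (c ^ 2 + c₂ ^ 2 - tpp ^ 2) + 32 * d * (Δ + ε) * (c + c₂))
          * (x * y)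
      + (-16 * fsM5 tpd c c₂ ε - 64 * d * c * c₂ + 16 * d * (Δ + ε) * (c + c₂)) * (x ^ 2 + y ^ 2)
      + (64 * d * (c ^ 2 + c₂ ^ 2 - tpp ^ 2 + c * c₂)) * (x ^ 2 * y + x * y ^ 2)
      + (64 * d * c * c₂) * (x ^ 3 + y ^ 3) := by
  unfold charPoly6 cA fsD5 fsN5 fsM5
  ring

/-! ## §3 THE `t_pp″` LAW: an exact one-band `t″` at every energy -/

/-- With `c₂ = 0` the weights are the quartet's: `fsD5 = fsD`. [folklore] -/
theorem fsD5_zero (Δ tpd c ε : ℝ) : fsD5 Δ tpd c 0 ε = fsD Δ tpd c ε := by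
  unfold fsD5 fsD; ring

/-- With `c₂ = 0`: `fsN5 = fsN`. [folklore] -/
theorem fsN5_zero (tpd tpp c ε : ℝ) : fsN5 tpd tpp c 0 ε = fsN tpd tpp c ε := by
  unfold fsN5 fsN; ring

/-- With `c₂ = 0` there is no `x² + y²` weight: `fsM5 = 0` — the quartet generates no `t″` (§B.13).
[folklore] -/
theorem fsM5_zero (tpd c ε : ℝ) : fsM5 tpd c 0 ε = 0 := by
  unfold fsM5; ring

/-- THE `t_pp″` MODEL AT FIXED ENERGY IS A SYMMETRIC QUADRATIC with an `x² + y²` term: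
`charPoly6|_{d=0} = cA − 4·fsD5·(x + y) − 16·fsN5·xy − 16·fsM5·(x² + y²)`. [folklore] -/
theorem charPoly6_tdd_zero_symQuad (Δ tpd tpp c c₂ x y ε : ℝ) :
    charPoly6 Δ tpd tpp c c₂ 0 x y ε =
      cA Δ ε - 4 * fsD5 Δ tpd c c₂ ε * (x + y) - 16 * fsN5 tpd tpp c c₂ ε * (x * y)
        - 16 * fsM5 tpd c c₂ ε * (x ^ 2 + y ^ 2) := by
  unfold charPoly6 cA fsD5 fsN5 fsM5
  ring

/-- Shape-normalised nearest-neighbour hopping of the `t_pp″`-model contour at energy `ε`: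
`fsT5 = fsD5 + 2fsN5 + 4fsM5` (conventional scale; `fsT5 = fsT` at `c₂ = 0`). [folklore] -/
def fsT5 (Δ tpd tpp c c₂ ε : ℝ) : ℝ :=
  fsD5 Δ tpd c c₂ ε + 2 * fsN5 tpd tpp c c₂ ε + 4 * fsM5 tpd c c₂ ε

/-- Shape-normalised diagonal hopping of the contour: `fsTp5 = −fsN5`. [folklore] -/
def fsTp5 (tpd tpp c c₂ ε : ℝ) : ℝ := -fsN5 tpd tpp c c₂ ε

/-- Shape-normalised third-neighbour hopping of the contour: `fsTpp5 = −fsM5 = −c₂(t_pd² − cε)`.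
[folklore] -/
def fsTpp5 (tpd c c₂ ε : ℝ) : ℝ := -fsM5 tpd c c₂ ε

/-- The `t_pp″`-model secular polynomial IS (minus) a `t–t′–t″` one-band form in `(x, y)` up to an additive
constant: `charPoly6|_{d=0} = cA − [oneBandXY γ fsT5 fsTp5 fsTpp5 − (γ − 4fsT5 − 4fsTp5 − 4fsTpp5)]`.
[folklore] -/
theorem charPoly6_tdd_zero_eq_oneBandXY (Δ tpd tpp c c₂ x y ε γ : ℝ) :
    charPoly6 Δ tpd tpp c c₂ 0 x y ε =
      cA Δ ε - (oneBandXY γ (fsT5 Δ tpd tpp c c₂ ε) (fsTp5 tpd tpp c c₂ ε) (fsTpp5 tpd c c₂ ε) x y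
        - (γ - 4 * fsT5 Δ tpd tpp c c₂ ε - 4 * fsTp5 tpd tpp c c₂ ε - 4 * fsTpp5 tpd c c₂ ε)) := by
  rw [charPoly6_tdd_zero_symQuad]
  unfold oneBandXY fsT5 fsTp5 fsTpp5
  ring

/-- THE `t_pp″` CONTOUR THEOREM in `(x, y)`: `charPoly6|_{d=0}(x, y, ε) = 0` iff `(x, y)` lies on the level set
`oneBandXY γ fsT5 fsTp5 fsTpp5 = γ − 4fsT5 − 4fsTp5 − 4fsTpp5 + cA(ε)` of the `t–t′–t″` form with
`t′/t = fsTp5/fsT5` and `t″/t = fsTpp5/fsT5`. Holds for each of the three bands at its own energies.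
[cite: AndersenEtAl1995, §6] -/
theorem charPoly6_tdd_zero_eq_zero_iff_oneBandXY (Δ tpd tpp c c₂ x y ε γ : ℝ) :
    charPoly6 Δ tpd tpp c c₂ 0 x y ε = 0 ↔
      oneBandXY γ (fsT5 Δ tpd tpp c c₂ ε) (fsTp5 tpd tpp c c₂ ε) (fsTpp5 tpd c c₂ ε) x y
        = γ - 4 * fsT5 Δ tpd tpp c c₂ ε - 4 * fsTp5 tpd tpp c c₂ ε - 4 * fsTpp5 tpd c c₂ ε + cA Δ ε := by
  rw [charPoly6_tdd_zero_eq_oneBandXY Δ tpd tpp c c₂ x y ε γ]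
  constructor <;> intro h <;> linarith

/-- THE `t_pp″` CONTOUR THEOREM in k-space: `ε` is a band energy of the σ + `t_pp″` model at `k = (kx, ky)`
iff `k` lies on the constant-energy contour `oneBand γ fsT5 fsTp5 fsTpp5 k = γ − 4fsT5 − 4fsTp5 − 4fsTpp5 +
cA(ε)` of the `t–t′–t″` one-band dispersion: every constant-energy contour — in particular the Fermi surface at
any filling — is EXACTLY a `t–t′–t″` contour with `t″/t′ = fsM5/fsN5`. [cite: AndersenEtAl1995, §6] -/
theorem det_bloch6_tdd_zero_eq_zero_iff_oneBand (Δ tpd tpp c c₂ kx ky ε γ : ℝ) :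
    (bloch6 Δ tpd tpp c c₂ 0 (Real.sin (kx / 2)) (Real.sin (ky / 2))
        - ε • (1 : Matrix (Fin 3) (Fin 3) ℝ)).det = 0 ↔
      oneBand γ (fsT5 Δ tpd tpp c c₂ ε) (fsTp5 tpd tpp c c₂ ε) (fsTpp5 tpd c c₂ ε) kx ky
        = γ - 4 * fsT5 Δ tpd tpp c c₂ ε - 4 * fsTp5 tpd tpp c c₂ ε - 4 * fsTpp5 tpd c c₂ ε + cA Δ ε := by
  rw [det_bloch6_sub_eq_neg_charPoly6, neg_eq_zero, oneBand_eq_oneBandXY]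
  exact charPoly6_tdd_zero_eq_zero_iff_oneBandXY _ _ _ _ _ _ _ _ _

/-- THE EXACT ONE-BAND `t″/t′` GENERATED BY `t_pp″`: `fsTpp5/fsTp5 = fsM5/fsN5`. [folklore] -/
theorem fsTpp5_div_fsTp5 (tpd tpp c c₂ ε : ℝ) :
    fsTpp5 tpd c c₂ ε / fsTp5 tpd tpp c c₂ ε = fsM5 tpd c c₂ ε / fsN5 tpd tpp c c₂ ε := by
  unfold fsTpp5 fsTp5
  rw [neg_div_neg_eq]

/-- … in closed form: `t″/t′ = c₂(t_pd² − cε)/(2t_pd²(c + t_pp) + ε(t_pp² − c² − c₂²))`. [folklore] -/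
theorem fsM5_div_fsN5_eq (tpd tpp c c₂ ε : ℝ) :
    fsM5 tpd c c₂ ε / fsN5 tpd tpp c c₂ ε =
      c₂ * (tpd ^ 2 - c * ε) / (2 * tpd ^ 2 * (c + tpp) + ε * (tpp ^ 2 - c ^ 2 - c₂ ^ 2)) := rfl

/-- SIGN OF THE GENERATED `t″`: with `cε < t_pd²` the contour's `t″ = fsTpp5 = −c₂(t_pd² − cε)` is POSITIVE
(the cuprate sign of [PavariniEtAl2001], opposite to `t′`) iff `c₂ < 0` — a negative same-sublattice hopping
(direct `ppπ` overlap) is cuprate-like, a positive one anti-cuprate. [folklore] -/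
theorem fsTpp5_pos_iff {tpd c c₂ ε : ℝ} (h : c * ε < tpd ^ 2) : 0 < fsTpp5 tpd c c₂ ε ↔ c₂ < 0 := by
  unfold fsTpp5 fsM5
  have hp : 0 < tpd ^ 2 - c * ε := by linarith
  constructor
  · intro h0
    by_contra hc
    have : 0 ≤ c₂ * (tpd ^ 2 - c * ε) := mul_nonneg (not_lt.mp hc) hp.le
    linarith
  · intro hc
    have : c₂ * (tpd ^ 2 - c * ε) < 0 := mul_neg_of_neg_of_pos hc hp
    linarith

/-- … and NEGATIVE (same sign as `t′`, anti-cuprate) iff `c₂ > 0`. [folklore] -/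
theorem fsTpp5_neg_iff {tpd c c₂ ε : ℝ} (h : c * ε < tpd ^ 2) : fsTpp5 tpd c c₂ ε < 0 ↔ 0 < c₂ := by
  unfold fsTpp5 fsM5
  have hp : 0 < tpd ^ 2 - c * ε := by linarith
  constructor
  · intro h0
    by_contra hc
    have : c₂ * (tpd ^ 2 - c * ε) ≤ 0 := mul_nonpos_of_nonpos_of_nonneg (not_lt.mp hc) hp.le
    linarith
  · intro hc
    have : 0 < c₂ * (tpd ^ 2 - c * ε) := mul_pos hc hp
    linarith

/-- In the cuprate regime the `xy` weight stays positive with `t_pp″`: `t_pd ≠ 0`, `0 < c + t_pp`, `0 ≤ ε`,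
`c² + c₂² ≤ t_pp²` give `fsN5 ≥ 2t_pd²(c + t_pp) > 0`. [folklore] -/
theorem fsN5_pos {tpd tpp c c₂ ε : ℝ} (htpd : tpd ≠ 0) (hct : 0 < c + tpp) (hε : 0 ≤ ε)
    (hcc : c ^ 2 + c₂ ^ 2 ≤ tpp ^ 2) : 0 < fsN5 tpd tpp c c₂ ε := by
  unfold fsN5
  have h2 : 0 < tpd ^ 2 := by positivity
  have h3 : 0 ≤ ε * (tpp ^ 2 - c ^ 2 - c₂ ^ 2) := mul_nonneg hε (by linarith)
  nlinarith [mul_pos h2 hct]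

/-- A lower bound used by the energy-free ratio bound: `2t_pd²(c + t_pp) ≤ fsN5` for `0 ≤ ε`,
`c² + c₂² ≤ t_pp²`. [folklore] -/
theorem two_mul_le_fsN5 {tpd tpp c c₂ ε : ℝ} (hε : 0 ≤ ε) (hcc : c ^ 2 + c₂ ^ 2 ≤ tpp ^ 2) :
    2 * tpd ^ 2 * (c + tpp) ≤ fsN5 tpd tpp c c₂ ε := by
  unfold fsN5
  have h3 : 0 ≤ ε * (tpp ^ 2 - c ^ 2 - c₂ ^ 2) := mul_nonneg hε (by linarith)
  linarith

/-- `|fsM5| ≤ |c₂|·t_pd²` for `0 ≤ c`, `0 ≤ ε`, `cε ≤ t_pd²`. [folklore] -/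
theorem abs_fsM5_le {tpd c c₂ ε : ℝ} (hc : 0 ≤ c) (hε : 0 ≤ ε) (hce : c * ε ≤ tpd ^ 2) :
    |fsM5 tpd c c₂ ε| ≤ |c₂| * tpd ^ 2 := by
  unfold fsM5
  rw [abs_mul]
  have h1 : 0 ≤ tpd ^ 2 - c * ε := by linarith
  have h2 : |tpd ^ 2 - c * ε| ≤ tpd ^ 2 := by
    rw [abs_of_nonneg h1]
    nlinarith [mul_nonneg hc hε]
  exact mul_le_mul_of_nonneg_left h2 (abs_nonneg _)

/-- THE ENERGY-FREE SIZE BOUND ON THE GENERATED `t″`: in the regime `t_pd ≠ 0`, `0 ≤ c`, `0 < c + t_pp`,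
`0 ≤ ε`, `cε ≤ t_pd²`, `c² + c₂² ≤ t_pp²` the exact one-band ratio of every constant-energy contour of the
σ + `t_pp″` model obeys **`|t″/t′| = |fsM5/fsN5| ≤ |c₂|/(2(c + t_pp))`** — no Fermi energy needed.
[folklore] -/
theorem abs_fsM5_div_fsN5_le {tpd tpp c c₂ ε : ℝ} (htpd : tpd ≠ 0) (hc : 0 ≤ c) (hct : 0 < c + tpp)
    (hε : 0 ≤ ε) (hce : c * ε ≤ tpd ^ 2) (hcc : c ^ 2 + c₂ ^ 2 ≤ tpp ^ 2) :
    |fsM5 tpd c c₂ ε / fsN5 tpd tpp c c₂ ε| ≤ |c₂| / (2 * (c + tpp)) := by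
  have hN : 0 < fsN5 tpd tpp c c₂ ε := fsN5_pos htpd hct hε hcc
  have h2 : 0 < tpd ^ 2 := by positivity
  rw [abs_div, abs_of_pos hN, div_le_div_iff₀ hN (by positivity)]
  calc |fsM5 tpd c c₂ ε| * (2 * (c + tpp))
      ≤ |c₂| * tpd ^ 2 * (2 * (c + tpp)) :=
        mul_le_mul_of_nonneg_right (abs_fsM5_le hc hε hce) (by positivity)
    _ = |c₂| * (2 * tpd ^ 2 * (c + tpp)) := by ring
    _ ≤ |c₂| * fsN5 tpd tpp c c₂ ε :=
        mul_le_mul_of_nonneg_left (two_mul_le_fsN5 hε hcc) (abs_nonneg _)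

/-- The same bound for the contour hoppings: `|fsTpp5/fsTp5| ≤ |c₂|/(2(c + t_pp))`. [folklore] -/
theorem abs_fsTpp5_div_fsTp5_le {tpd tpp c c₂ ε : ℝ} (htpd : tpd ≠ 0) (hc : 0 ≤ c) (hct : 0 < c + tpp)
    (hε : 0 ≤ ε) (hce : c * ε ≤ tpd ^ 2) (hcc : c ^ 2 + c₂ ^ 2 ≤ tpp ^ 2) :
    |fsTpp5 tpd c c₂ ε / fsTp5 tpd tpp c c₂ ε| ≤ |c₂| / (2 * (c + tpp)) := by
  rw [fsTpp5_div_fsTp5]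
  exact abs_fsM5_div_fsN5_le htpd hc hct hε hce hcc

/-- THE NESTING-FOLD SHIFT: on the nesting line a `t–t′–t″` contour reads as a `t–t′_eff` one with
`t′_eff = t′ − 2t″` (`OneBandNestingFold`); the `t_pp″`-generated relative shift is `|2t″/t′| ≤ |c₂|/(c + t_pp)`.
[folklore] -/
theorem abs_two_mul_fsM5_div_fsN5_le {tpd tpp c c₂ ε : ℝ} (htpd : tpd ≠ 0) (hc : 0 ≤ c)
    (hct : 0 < c + tpp) (hε : 0 ≤ ε) (hce : c * ε ≤ tpd ^ 2) (hcc : c ^ 2 + c₂ ^ 2 ≤ tpp ^ 2) :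
    |2 * (fsM5 tpd c c₂ ε / fsN5 tpd tpp c c₂ ε)| ≤ |c₂| / (c + tpp) := by
  rw [abs_mul, abs_two]
  have h := abs_fsM5_div_fsN5_le htpd hc hct hε hce hcc
  have hct' : (c + tpp) ≠ 0 := ne_of_gt hct
  have heq : 2 * (|c₂| / (2 * (c + tpp))) = |c₂| / (c + tpp) := by
    field_simp
  calc 2 * |fsM5 tpd c c₂ ε / fsN5 tpd tpp c c₂ ε| ≤ 2 * (|c₂| / (2 * (c + tpp))) := by linarith
    _ = |c₂| / (c + tpp) := heq

/-! ## §4 THE `t_dd` LAW: exact `t″` and `t‴`, no `(2,2)` harmonic -/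

/-- The exact `(2,1)` harmonic generated by `t_dd` (in the cubic's conventional units):
`ddT3 = d(t_pp² − c²)` — nonzero iff `d ≠ 0` and `t_pp² ≠ c²`: the direct Cu–Cu hopping reaches the
`cos 2kx cos ky` star only THROUGH the oxygen hoppings. [folklore] -/
def ddT3 (tpp c d : ℝ) : ℝ := d * (tpp ^ 2 - c ^ 2)

/-- The exact `(2,0)` harmonic generated by `t_dd`: `ddT2 = d((Δ + ε)c − 2(t_pp² − c²))`. [folklore] -/
def ddT2 (Δ tpp c d ε : ℝ) : ℝ := d * ((Δ + ε) * c - 2 * (tpp ^ 2 - c ^ 2))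

/-- The contour's diagonal hopping with `t_dd`: `ddT1 = −fsN + 2·ddT2`. [folklore] -/
def ddT1 (Δ tpd tpp c d ε : ℝ) : ℝ := -fsN tpd tpp c ε + 2 * ddT2 Δ tpp c d ε

/-- The contour's nearest-neighbour hopping with `t_dd`:
`ddT = fsT − d((Δ + ε)² + 4(Δ + ε)c − 6(t_pp² − c²))`. [folklore] -/
def ddT (Δ tpd tpp c d ε : ℝ) : ℝ :=
  fsT Δ tpd tpp c ε - d * ((Δ + ε) ^ 2 + 4 * (Δ + ε) * c - 6 * (tpp ^ 2 - c ^ 2))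

/-- The k-independent part with `t_dd`: `ddK = cA − 4(fsD + fsN) + 4d((Δ + ε)c − 2(t_pp² − c²))`.
[folklore] -/
def ddK (Δ tpd tpp c d ε : ℝ) : ℝ :=
  cA Δ ε - 4 * (fsD Δ tpd c ε + fsN tpd tpp c ε) + 4 * d * ((Δ + ε) * c - 2 * (tpp ^ 2 - c ^ 2))

/-- THE `t_dd` LAW IN COSINES: at `sx = sin(kx/2)`, `sy = sin(ky/2)` and `c₂ = 0`,
`charPoly6 = ddK − oneBand5 ddT ddT1 ddT2 ddT3 0` — a four-harmonic one-band form with NO `(2,2)` star.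
[cite: AndersenEtAl1995, §6] -/
theorem charPoly6_c2_zero_cos (Δ tpd tpp c d kx ky ε : ℝ) :
    charPoly6 Δ tpd tpp c 0 d (Real.sin (kx / 2) ^ 2) (Real.sin (ky / 2) ^ 2) ε =
      ddK Δ tpd tpp c d ε
        - oneBand5 (ddT Δ tpd tpp c d ε) (ddT1 Δ tpd tpp c d ε) (ddT2 Δ tpp c d ε) (ddT3 tpp c d) 0
            kx ky := by
  unfold charPoly6 ddK ddT ddT1 ddT2 ddT3 oneBand5 fsT fsD fsN cA
  rw [cos_two_mul_eq_sin_half kx, cos_two_mul_eq_sin_half ky,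
    Literature.Probability.LatticeModels.cos_eq_one_sub_two_mul_sin_half_sq kx,
    Literature.Probability.LatticeModels.cos_eq_one_sub_two_mul_sin_half_sq ky]
  ring

/-- THE `t_dd` CONTOUR THEOREM in k-space: `ε` is a band energy of the σ + `t_dd` model at `k` iff `k` lies
on the constant-energy contour `oneBand5 ddT ddT1 ddT2 ddT3 0 k = ddK(ε)`: every constant-energy contour — in
particular the Fermi surface at any filling — is EXACTLY a `t–t′–t″–t‴` contour (harmonics `(1,0)`, `(1,1)`,
`(2,0)`, `(2,1)`; no `(2,2)`). [cite: AndersenEtAl1995, §6] -/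
theorem det_bloch6_c2_zero_eq_zero_iff_oneBand5 (Δ tpd tpp c d kx ky ε : ℝ) :
    (bloch6 Δ tpd tpp c 0 d (Real.sin (kx / 2)) (Real.sin (ky / 2))
        - ε • (1 : Matrix (Fin 3) (Fin 3) ℝ)).det = 0 ↔
      oneBand5 (ddT Δ tpd tpp c d ε) (ddT1 Δ tpd tpp c d ε) (ddT2 Δ tpp c d ε) (ddT3 tpp c d) 0 kx ky
        = ddK Δ tpd tpp c d ε := by
  rw [det_bloch6_sub_eq_neg_charPoly6, neg_eq_zero, charPoly6_c2_zero_cos]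
  constructor <;> intro h <;> linarith

/-- With `d = 0` the four hoppings are the quartet's `(fsT, −fsN, 0, 0)` (§B.13). [folklore] -/
theorem ddT_zero (Δ tpd tpp c ε : ℝ) :
    ddT Δ tpd tpp c 0 ε = fsT Δ tpd tpp c ε ∧ ddT1 Δ tpd tpp c 0 ε = -fsN tpd tpp c ε ∧
      ddT2 Δ tpp c 0 ε = 0 ∧ ddT3 tpp c 0 = 0 := by
  unfold ddT ddT1 ddT2 ddT3
  refine ⟨by ring, by ring, by ring, by ring⟩

/-- The `(2,1)` harmonic vanishes iff `d = 0` or `t_pp² = c²`. [folklore] -/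
theorem ddT3_eq_zero_iff (tpp c d : ℝ) : ddT3 tpp c d = 0 ↔ d = 0 ∨ tpp ^ 2 = c ^ 2 := by
  unfold ddT3
  rw [mul_eq_zero, sub_eq_zero]

/-- THE `t‴/t″` RATIO DOES NOT DEPEND ON `t_dd`: `ddT3/ddT2 = (t_pp² − c²)/((Δ + ε)c − 2(t_pp² − c²))`
(`d ≠ 0`). [folklore] -/
theorem ddT3_div_ddT2 {d : ℝ} (hd : d ≠ 0) (Δ tpp c ε : ℝ) :
    ddT3 tpp c d / ddT2 Δ tpp c d ε = (tpp ^ 2 - c ^ 2) / ((Δ + ε) * c - 2 * (tpp ^ 2 - c ^ 2)) := by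
  unfold ddT3 ddT2
  rw [mul_div_mul_left _ _ hd]

/-! ## §5 Scale covariance -/

/-- `charPoly6` is homogeneous of degree 3 under `(Δ, t_pd, t_pp, c, c₂, d, ε) ↦ λ·(…)` at fixed k: a common
rescaling of all one-body energies moves no contour and no hopping RATIO. [folklore] -/
theorem charPoly6_smul (l Δ tpd tpp c c₂ d x y ε : ℝ) :
    charPoly6 (l * Δ) (l * tpd) (l * tpp) (l * c) (l * c₂) (l * d) x y (l * ε) =
      l ^ 3 * charPoly6 Δ tpd tpp c c₂ d x y ε := by
  unfold charPoly6
  ring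

/-- The ratio `fsM5/fsN5` (the generated `t″/t′`) is scale invariant (`λ ≠ 0`). [folklore] -/
theorem fsM5_div_fsN5_smul {l : ℝ} (hl : l ≠ 0) (tpd tpp c c₂ ε : ℝ) :
    fsM5 (l * tpd) (l * c) (l * c₂) (l * ε) / fsN5 (l * tpd) (l * tpp) (l * c) (l * c₂) (l * ε) =
      fsM5 tpd c c₂ ε / fsN5 tpd tpp c c₂ ε := by
  have h3 : l ^ 3 ≠ 0 := pow_ne_zero 3 hl
  have hM : fsM5 (l * tpd) (l * c) (l * c₂) (l * ε) = l ^ 3 * fsM5 tpd c c₂ ε := by unfold fsM5; ring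
  have hN : fsN5 (l * tpd) (l * tpp) (l * c) (l * c₂) (l * ε) = l ^ 3 * fsN5 tpd tpp c c₂ ε := by
    unfold fsN5; ring
  rw [hM, hN, mul_div_mul_left _ _ h3]

end Summit.Ventures.CertifiedManyBodySolver.Downfold.Emery
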